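import Literature.AlgebraicGeometry.Resolution.CentreBlowupOrdAlongBasics
import HarnessLib
import HarnessLib.Audit.Tags

/-!
# Purely inseparable fourfolds `z^p + F(x₁,…,x₄)` — SPINE CERTIFICATES (kernel-decidable mirror of the spine game)

Census cell «res-dim4-pi» (D-0157 DOOR 2), WAVE-3 row W3-3 («Lean certifier, SPINE GAME»); seat res-dim4-p-8.
[OURS · counted 0 · AI kernel work, weaker than expert review.]  Nothing in this file is a statement
about resolution of singularities; nothing here proves resolution in dimension ≥ 4 / characteristic `p`.

On SPINE edges (chart origins, `b = 0`) the coordinate-centre walk of the cell, read on SUPPORTS, is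
Hironaka's constrained polyhedra game in four variables (desk WORD #22 / #23 (b); typed by the desk as
`PurelyInseparableDim4SpineGame`: positions `Finset (Fin 4 →₀ ℕ)`, permissible `J` = `q ≤ Σ_{i∈J} aᵢ` on
the position, move `a_j ↦ Σ_{i∈J} aᵢ − q`, player B picks the chart `j ∈ J`, player A has won when the
position is empty or holds a point of total degree `< q`).  Those definitions live on `Finsupp` and are
not kernel-computable.  This file is the CERTIFIER the census needs (PLOT-AUDIT § RESOLUTION: «kernel
facts, not python ‖ python»):

* §1 a COMPUTABLE MIRROR of the game on plain exponent functions `Fin 4 → ℕ`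
  (`degInC`, `chartExpC`, `pureMoveC`, `spineMoveC`) with `Bool`-valued tests `wonB`, `permB`,
  `cardFirstB` (= the support shadow of the MODE-1h rule of record: a permissible `J` of LEAST
  cardinality, every tie allowed), `stepB`;
* §2 the dictionary to the tree's `CentreBlowup.degIn` / `CentreBlowup.chartExponent` on `Fin 4 →₀ ℕ`
  (coefficient-free bookkeeping: `⇑(chartExponent q J j d) = chartExpC q J j ⇑d`);
* §3 a LITERAL-CYCLE CHECKER `CycleCert q L` for a list of `(position, centre, chart)` triples —
  every entry is a not-yet-won position, its centre is cardinality-first permissible, the chart lies in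
  the centre, the pure move lands LITERALLY on the next entry (cyclically), and the positions are
  pairwise distinct — decidable by `decide`, with the soundness lemmas that turn a certificate into a
  periodic infinite play of the mirror game (`CycleCert.play_succ`, `…not_won`, `…cardFirst`);
* §4 the census specimens at `q = 2` as kernel facts: C-003 (crit-1 K-A-01, the support shadow of the
  tree theorem `Mode1hTwoCycle.not_terminates1h_two`, period 2), C-006 (idea-6, period 2, centres =
  coordinate 3-planes) and C-002 (eng-A / crit-2, period 3) — each `CycleCert 2 … ` by `decide`,
  together with the TIE STRUCTURE at every cycle position (the full list of least-cardinality
  permissible centres, also by `decide`): all three cycles run THROUGH TIES of the cardinality-first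
  rule, so what they certify is «SOME tie-breaking of cardinality-first admits an infinite pure play»
  (N-CF of boards/ROUTES.md WORD #23 (b), ∃-over-ties form), not «every cardinality-first positional
  strategy loses».

The transfer of these certificates to the desk's `SpineGame` vocabulary (`pureMove`, `SpinePermissible`,
`SpineWon`, `IsPurePlay`, `IsPurePositionalWin`) is the companion file `…SpineCertCycles` (after TY-9
lands).  Sources of the notions: [cite: Spivakovsky1983, §1 (Hironaka's polyhedra game: permissible
sets, the move, the winning condition Σ xⱼ < 1)] [cite: HauserPerlega2019PRIMS, §2 (the blowup in the
x₁-chart)]; the cycles are OURS (census boards/JUMPS.md §3 rows C-002, C-003, C-006).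

bears_on: LADDER-RESOLUTION:D157-DOOR2 (res-dim4-pi · W3-3). Supports stmt-ResolutionOfSingularities-16155 (helper).
-/

-- cell convention (DR-157-C): the summit's doubled path segment is intended, as in the landed Target file
set_option linter.dupNamespace false

namespace Summit.ResolutionOfSingularities.ResolutionOfSingularities.Theorems.PIDim4.SpineCert

open Finset
open Literature.AlgebraicGeometry.Resolution

/-! ## 1. The computable mirror of the spine game -/

/-- `Σ_{i∈J} aᵢ` on a plain exponent function (mirror of `CentreBlowup.degIn`).
[cite: HauserPerlega2019PRIMS, §2 (ord_P of a monomial)] -/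
def degInC (J : Finset (Fin 4)) (a : Fin 4 → ℕ) : ℕ := ∑ i ∈ J, a i

/-- The chart law `a_j ↦ Σ_{i∈J} aᵢ − q`, `aᵢ ↦ aᵢ (i ≠ j)` on plain exponent functions (mirror of
`CentreBlowup.chartExponent`). [cite: HauserPerlega2019PRIMS, §2 (the blowup in the x₁-chart)] -/
def chartExpC (q : ℕ) (J : Finset (Fin 4)) (j : Fin 4) (a : Fin 4 → ℕ) : Fin 4 → ℕ :=
  Function.update a j (degInC J a - q)

/-- The PURE move of Hironaka's game on a position (mirror of `PIDim4.pureMove`).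
[cite: Spivakovsky1983, §1 (the transformation σ_{Γ,i})] -/
def pureMoveC (q : ℕ) (J : Finset (Fin 4)) (j : Fin 4) (A : Finset (Fin 4 → ℕ)) :
    Finset (Fin 4 → ℕ) :=
  A.image (chartExpC q J j)

/-- The SPINE move: the pure move followed by deletion of the `q`-divisible points (cleaning; mirror of
`PIDim4.spineMove`). [folklore] -/
def spineMoveC (q : ℕ) (J : Finset (Fin 4)) (j : Fin 4) (A : Finset (Fin 4 → ℕ)) :
    Finset (Fin 4 → ℕ) :=
  (pureMoveC q J j A).filter fun a => ¬ ∀ i, q ∣ a i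

/-- Test: player A has won at `A` (empty, or a point of total degree `< q`; mirror of `PIDim4.SpineWon`).
[cite: Spivakovsky1983, §1 (A wins if some point has Σ xⱼ < 1)] -/
def wonB (q : ℕ) (A : Finset (Fin 4 → ℕ)) : Bool :=
  decide (A = ∅ ∨ ∃ a ∈ A, degInC Finset.univ a < q)

/-- Test: `J` is permissible at `A` (`J ≠ ∅`, `q ≤ Σ_{i∈J} aᵢ` on the position; mirror of
`PIDim4.SpinePermissible`). [cite: Spivakovsky1983, §1 (permissible sets)] -/
def permB (q : ℕ) (J : Finset (Fin 4)) (A : Finset (Fin 4 → ℕ)) : Bool :=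
  decide (J.Nonempty ∧ ∀ a ∈ A, q ≤ degInC J a)

/-- Test: `J` is CARDINALITY-FIRST at `A` — permissible and of least cardinality among the permissible
centres (the support shadow of the cell's MODE 1h = `PIDim4.IsMode1hCentre`; every tie allowed). [folklore] -/
def cardFirstB (q : ℕ) (J : Finset (Fin 4)) (A : Finset (Fin 4 → ℕ)) : Bool :=
  permB q J A && decide (∀ J' : Finset (Fin 4), permB q J' A = true → J.card ≤ J'.card)

/-- Test of ONE certified edge `A —(J, j)→ A'` of a cardinality-first pure play: `A` not yet won, `J`
cardinality-first permissible at `A`, `j ∈ J`, and the pure move lands literally on `A'`. [folklore] -/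
def stepB (q : ℕ) (A : Finset (Fin 4 → ℕ)) (J : Finset (Fin 4)) (j : Fin 4)
    (A' : Finset (Fin 4 → ℕ)) : Bool :=
  !wonB q A && cardFirstB q J A && decide (j ∈ J) && decide (pureMoveC q J j A = A')

/-! ### Unfolding the tests -/

/-- `wonB` says what it tests. [folklore] -/
theorem wonB_eq_true_iff (q : ℕ) (A : Finset (Fin 4 → ℕ)) :
    wonB q A = true ↔ (A = ∅ ∨ ∃ a ∈ A, degInC Finset.univ a < q) := by
  simp [wonB]

/-- `permB` says what it tests. [folklore] -/
theorem permB_eq_true_iff (q : ℕ) (J : Finset (Fin 4)) (A : Finset (Fin 4 → ℕ)) :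
    permB q J A = true ↔ (J.Nonempty ∧ ∀ a ∈ A, q ≤ degInC J a) := by
  simp [permB]

/-- `cardFirstB` says what it tests. [folklore] -/
theorem cardFirstB_eq_true_iff (q : ℕ) (J : Finset (Fin 4)) (A : Finset (Fin 4 → ℕ)) :
    cardFirstB q J A = true ↔
      (permB q J A = true ∧ ∀ J' : Finset (Fin 4), permB q J' A = true → J.card ≤ J'.card) := by
  simp [cardFirstB]

/-- `stepB` says what it tests. [folklore] -/
theorem stepB_eq_true_iff (q : ℕ) (A : Finset (Fin 4 → ℕ)) (J : Finset (Fin 4)) (j : Fin 4)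
    (A' : Finset (Fin 4 → ℕ)) :
    stepB q A J j A' = true ↔
      (wonB q A = false ∧ cardFirstB q J A = true ∧ j ∈ J ∧ pureMoveC q J j A = A') := by
  simp [stepB, Bool.and_eq_true, and_assoc]

/-! ## 2. Dictionary to the tree's `CentreBlowup` exponent bookkeeping -/

/-- `degInC` is `CentreBlowup.degIn` read on the coefficient function. [folklore] -/
theorem degInC_coe (J : Finset (Fin 4)) (d : Fin 4 →₀ ℕ) :
    degInC J ⇑d = CentreBlowup.degIn J d := rfl

/-- On all four variables `degInC` is the total degree. [folklore] -/
theorem degInC_univ_coe (d : Fin 4 →₀ ℕ) : degInC Finset.univ ⇑d = d.degree := by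
  rw [degInC_coe, CentreBlowup.degIn_univ]

/-- `chartExpC` is `CentreBlowup.chartExponent` read on coefficient functions. [folklore] -/
theorem coe_chartExponent (q : ℕ) (J : Finset (Fin 4)) (j : Fin 4) (d : Fin 4 →₀ ℕ) :
    ⇑(CentreBlowup.chartExponent q J j d) = chartExpC q J j ⇑d := by
  rw [CentreBlowup.chartExponent, Finsupp.coe_update]
  rfl

/-- Hence `chartExpC` transported along `Finsupp.equivFunOnFinite` is `CentreBlowup.chartExponent`. [folklore] -/
theorem chartExponent_eq_equivFunOnFinite_symm (q : ℕ) (J : Finset (Fin 4)) (j : Fin 4) (d : Fin 4 →₀ ℕ) :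
    CentreBlowup.chartExponent q J j d = Finsupp.equivFunOnFinite.symm (chartExpC q J j ⇑d) := by
  apply Finsupp.equivFunOnFinite.injective
  rw [Equiv.apply_symm_apply]
  exact coe_chartExponent q J j d

/-! ## 3. The literal-cycle checker and its soundness -/

/-- **Cycle certificate**: a nonempty list of `(position, centre, chart)` triples with pairwise distinct
positions such that every entry is a certified cardinality-first edge onto the NEXT entry, cyclically.
Decidable, so concrete certificates are checked by `decide`. [folklore] -/
def CycleCert (q : ℕ) (L : List (Finset (Fin 4 → ℕ) × Finset (Fin 4) × Fin 4)) : Prop :=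
  L ≠ [] ∧ (L.map Prod.fst).Nodup ∧
    ∀ k : Fin L.length,
      stepB q (L.get k).1 (L.get k).2.1 (L.get k).2.2
        (L.get ⟨(k.1 + 1) % L.length, Nat.mod_lt _ k.pos⟩).1 = true

namespace CycleCert

variable {q : ℕ} {L : List (Finset (Fin 4 → ℕ) × Finset (Fin 4) × Fin 4)}

/-- A certified list is nonempty. [folklore] -/
theorem length_pos (h : CycleCert q L) : 0 < L.length :=
  List.length_pos_iff.mpr h.1

/-- The index visited at time `n` of the periodic play. [folklore] -/
def idx (h : CycleCert q L) (n : ℕ) : Fin L.length := ⟨n % L.length, Nat.mod_lt _ h.length_pos⟩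

/-- The periodic PLAY read off the certificate: position at time `n`. [folklore] -/
def play (h : CycleCert q L) (n : ℕ) : Finset (Fin 4 → ℕ) := (L.get (h.idx n)).1

/-- The centre blown up at time `n`. [folklore] -/
def centre (h : CycleCert q L) (n : ℕ) : Finset (Fin 4) := (L.get (h.idx n)).2.1

/-- The chart chosen by player B at time `n`. [folklore] -/
def chart (h : CycleCert q L) (n : ℕ) : Fin 4 := (L.get (h.idx n)).2.2

/-- The index at time `n + 1` is the cyclic successor of the index at time `n`. [folklore] -/
theorem idx_succ (h : CycleCert q L) (n : ℕ) :
    h.idx (n + 1) = ⟨((h.idx n).1 + 1) % L.length, Nat.mod_lt _ h.length_pos⟩ := by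
  apply Fin.ext
  simp [idx, Nat.add_mod]

/-- The certified edge at time `n`. [folklore] -/
theorem stepB_play (h : CycleCert q L) (n : ℕ) :
    stepB q (h.play n) (h.centre n) (h.chart n) (h.play (n + 1)) = true := by
  have := h.2.2 (h.idx n)
  rw [play, play, centre, chart, idx_succ]
  exact this

/-- Along the play no position is won. [folklore] -/
theorem not_won (h : CycleCert q L) (n : ℕ) : wonB q (h.play n) = false :=
  ((stepB_eq_true_iff _ _ _ _ _).mp (h.stepB_play n)).1

/-- Along the play every centre is cardinality-first permissible. [folklore] -/
theorem cardFirst (h : CycleCert q L) (n : ℕ) : cardFirstB q (h.centre n) (h.play n) = true :=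
  ((stepB_eq_true_iff _ _ _ _ _).mp (h.stepB_play n)).2.1

/-- Along the play every centre is permissible. [folklore] -/
theorem perm (h : CycleCert q L) (n : ℕ) : permB q (h.centre n) (h.play n) = true :=
  ((cardFirstB_eq_true_iff _ _ _).mp (h.cardFirst n)).1

/-- Along the play no permissible centre is smaller than the one used. [folklore] -/
theorem card_le (h : CycleCert q L) (n : ℕ) (J' : Finset (Fin 4)) (hJ' : permB q J' (h.play n) = true) :
    (h.centre n).card ≤ J'.card :=
  ((cardFirstB_eq_true_iff _ _ _).mp (h.cardFirst n)).2 J' hJ'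

/-- Along the play the chart lies in the centre. [folklore] -/
theorem chart_mem (h : CycleCert q L) (n : ℕ) : h.chart n ∈ h.centre n :=
  ((stepB_eq_true_iff _ _ _ _ _).mp (h.stepB_play n)).2.2.1

/-- Along the play the next position is the pure move of the current one. [folklore] -/
theorem play_succ (h : CycleCert q L) (n : ℕ) :
    h.play (n + 1) = pureMoveC q (h.centre n) (h.chart n) (h.play n) :=
  ((stepB_eq_true_iff _ _ _ _ _).mp (h.stepB_play n)).2.2.2.symm

/-- The play starts at the head of the certificate. [folklore] -/
theorem play_zero (h : CycleCert q L) : h.play 0 = (L.get ⟨0, h.length_pos⟩).1 := by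
  simp [play, idx]

/-- A position of the certificate determines its entry (positions are pairwise distinct). [folklore] -/
theorem get_eq_of_fst_eq (h : CycleCert q L) {k k' : Fin L.length}
    (hkk' : (L.get k).1 = (L.get k').1) : k = k' := by
  have hnd := h.2.1
  rw [List.nodup_iff_injective_get] at hnd
  have h1 : (L.map Prod.fst).get ⟨k.1, by simp⟩ = (L.map Prod.fst).get ⟨k'.1, by simp⟩ := by
    simpa using hkk'
  have h2 := congrArg Fin.val (hnd h1)
  exact Fin.ext (by simpa using h2)

end CycleCert

/-! ## 4. The census specimens at `q = 2` (boards/JUMPS.md §3) -/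

/-! ### C-003 — crit-1 K-A-01 (support shadow of `Mode1hTwoCycle.not_terminates1h_two`)
State of record `s₁ = (x₂x₃²x₄² + x₂x₃³x₄ + x₁x₂x₃x₄³, r = 0, exc = {x₁})`; 1h centres `{x₁,x₃}` /
`{x₁,x₄}` alternately, `x₁`-chart origins.  Variables `x₁,…,x₄` = indices `0,…,3`. -/

/-- Position of C-003: the support of `x₂x₃²x₄² + x₂x₃³x₄ + x₁x₂x₃x₄³`. [folklore] -/
def c003A₀ : Finset (Fin 4 → ℕ) := {![0, 1, 2, 2], ![0, 1, 3, 1], ![1, 1, 1, 3]}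

/-- Position of C-003 after the `x₁`-chart of the blow-up of `V(z, x₁, x₃)` (= `c003A₀` with `x₃ ↔ x₄`). [folklore] -/
def c003A₁ : Finset (Fin 4 → ℕ) := {![0, 1, 1, 3], ![0, 1, 2, 2], ![1, 1, 3, 1]}

/-- The C-003 certificate: `A₀ —({x₁,x₃}, x₁)→ A₁ —({x₁,x₄}, x₁)→ A₀`. [folklore] -/
def c003 : List (Finset (Fin 4 → ℕ) × Finset (Fin 4) × Fin 4) :=
  [(c003A₀, {0, 2}, 0), (c003A₁, {0, 3}, 0)]

/-- **C-003 is a literal cardinality-first 2-cycle of the pure game at `q = 2`** (kernel check).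
[OURS · ‖ K] [folklore] -/
theorem cycleCert_c003 : CycleCert 2 c003 := by
  unfold CycleCert c003 c003A₀ c003A₁
  decide

/-- TIES at `c003A₀`: the cardinality-first centres there are exactly the four pairs
`{x₁,x₃}, {x₂,x₃}, {x₂,x₄}, {x₃,x₄}` — the cycle uses one of four tied choices. [OURS · ‖ K] [folklore] -/
theorem cardFirstB_c003A₀_iff (J : Finset (Fin 4)) :
    cardFirstB 2 J c003A₀ = true ↔ J ∈ ({{0, 2}, {1, 2}, {1, 3}, {2, 3}} : Finset (Finset (Fin 4))) := by
  revert J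
  unfold c003A₀
  decide

/-- TIES at `c003A₁`: the cardinality-first centres there are exactly
`{x₁,x₄}, {x₂,x₃}, {x₂,x₄}, {x₃,x₄}`. [OURS · ‖ K] [folklore] -/
theorem cardFirstB_c003A₁_iff (J : Finset (Fin 4)) :
    cardFirstB 2 J c003A₁ = true ↔ J ∈ ({{0, 3}, {1, 2}, {1, 3}, {2, 3}} : Finset (Finset (Fin 4))) := by
  revert J
  unfold c003A₁
  decide

/-- No cleaning deletion occurs along C-003: the spine move agrees with the pure move on both edges
(so the cycle is also a cycle of the game WITH deletions). [OURS · ‖ K] [folklore] -/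
theorem spineMoveC_eq_pureMoveC_c003 :
    spineMoveC 2 {0, 2} 0 c003A₀ = pureMoveC 2 {0, 2} 0 c003A₀ ∧
      spineMoveC 2 {0, 3} 0 c003A₁ = pureMoveC 2 {0, 3} 0 c003A₁ := by
  unfold c003A₀ c003A₁
  decide

/-! ### C-006 — idea-6 located type (Z) «spine all-C1 2-cycle»
State of record `F = x₁x₃² + x₁x₂³x₄ + x₁³x₄⁴`, `Δ = {x₁,x₄}`; 1h alternates the 3-planes
`{x₁,x₂,x₃}` / `{x₁,x₃,x₄}` in the `x₁`-chart, all at origins. -/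

/-- Position of C-006: the support of `x₁x₃² + x₁x₂³x₄ + x₁³x₄⁴`. [folklore] -/
def c006A₀ : Finset (Fin 4 → ℕ) := {![1, 0, 2, 0], ![1, 3, 0, 1], ![3, 0, 0, 4]}

/-- Position of C-006 after the `x₁`-chart of the blow-up of `V(z, x₁, x₂, x₃)`. [folklore] -/
def c006A₁ : Finset (Fin 4 → ℕ) := {![1, 0, 2, 0], ![2, 3, 0, 1], ![1, 0, 0, 4]}

/-- The C-006 certificate: `A₀ —({x₁,x₂,x₃}, x₁)→ A₁ —({x₁,x₃,x₄}, x₁)→ A₀`. [folklore] -/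
def c006 : List (Finset (Fin 4 → ℕ) × Finset (Fin 4) × Fin 4) :=
  [(c006A₀, {0, 1, 2}, 0), (c006A₁, {0, 2, 3}, 0)]

/-- **C-006 is a literal cardinality-first 2-cycle of the pure game at `q = 2`** whose centres are
coordinate 3-PLANES (no permissible pair exists at either position). [OURS · ‖ K] [folklore] -/
theorem cycleCert_c006 : CycleCert 2 c006 := by
  unfold CycleCert c006 c006A₀ c006A₁
  decide

/-- TIES at `c006A₀`: the cardinality-first centres are exactly the three 3-planes
`{x₁,x₂,x₃}, {x₁,x₃,x₄}, {x₂,x₃,x₄}`. [OURS · ‖ K] [folklore] -/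
theorem cardFirstB_c006A₀_iff (J : Finset (Fin 4)) :
    cardFirstB 2 J c006A₀ = true ↔ J ∈ ({{0, 1, 2}, {0, 2, 3}, {1, 2, 3}} : Finset (Finset (Fin 4))) := by
  revert J
  unfold c006A₀
  decide

/-- TIES at `c006A₁`: the cardinality-first centres are exactly `{x₁,x₃,x₄}, {x₂,x₃,x₄}`. [OURS · ‖ K] [folklore] -/
theorem cardFirstB_c006A₁_iff (J : Finset (Fin 4)) :
    cardFirstB 2 J c006A₁ = true ↔ J ∈ ({{0, 2, 3}, {1, 2, 3}} : Finset (Finset (Fin 4))) := by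
  revert J
  unfold c006A₁
  decide

/-! ### C-002 — eng-A / crit-2 lane C (period 3, «LINE centres»)
Cycle state of record `(y²w + xw³ + xv²w, r = 0, exc = {x})` in variables `(x,y,v,w) = (x₁,x₂,x₃,x₄)`;
centres the lines `V(z,x₁,x₂,x₄) → V(z,x₁,x₂,x₃) → V(z,x₁,x₃,x₄)`, `x₁`-charts, `t = 0`. -/

/-- Position of C-002: the support of `x₂²x₄ + x₁x₄³ + x₁x₃²x₄`. [folklore] -/
def c002A₀ : Finset (Fin 4 → ℕ) := {![0, 2, 0, 1], ![1, 0, 0, 3], ![1, 0, 2, 1]}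

/-- Second position of C-002. [folklore] -/
def c002A₁ : Finset (Fin 4 → ℕ) := {![0, 0, 2, 1], ![1, 2, 0, 1], ![2, 0, 0, 3]}

/-- Third position of C-002. [folklore] -/
def c002A₂ : Finset (Fin 4 → ℕ) := {![0, 0, 0, 3], ![0, 0, 2, 1], ![1, 2, 0, 1]}

/-- The C-002 certificate:
`A₀ —({x₁,x₂,x₄}, x₁)→ A₁ —({x₁,x₂,x₃}, x₁)→ A₂ —({x₁,x₃,x₄}, x₁)→ A₀`. [folklore] -/
def c002 : List (Finset (Fin 4 → ℕ) × Finset (Fin 4) × Fin 4) :=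
  [(c002A₀, {0, 1, 3}, 0), (c002A₁, {0, 1, 2}, 0), (c002A₂, {0, 2, 3}, 0)]

/-- **C-002 is a literal cardinality-first 3-cycle of the pure game at `q = 2`** (centres = lines of
`𝔸⁵`, i.e. coordinate 3-planes of the base). [OURS · ‖ K] [folklore] -/
theorem cycleCert_c002 : CycleCert 2 c002 := by
  unfold CycleCert c002 c002A₀ c002A₁ c002A₂
  decide

/-- TIES at `c002A₀`: the cardinality-first centres are exactly `{x₁,x₂,x₄}, {x₂,x₃,x₄}`. [OURS · ‖ K] [folklore] -/
theorem cardFirstB_c002A₀_iff (J : Finset (Fin 4)) :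
    cardFirstB 2 J c002A₀ = true ↔ J ∈ ({{0, 1, 3}, {1, 2, 3}} : Finset (Finset (Fin 4))) := by
  revert J
  unfold c002A₀
  decide

/-! ## 5. `Bool` form of the cycle checker (for batch certificates)

Appended 2026-08-28 (W3-3 batch lane): a long list literal of certificates elaborates with internal
`have` bindings, which blocks instance synthesis for `∀ c ∈ batch, CycleCert q c` after unfolding; the
`Bool` form lets the kernel evaluate `batch.all (cycleCertB q) = true` directly. -/

/-- `Bool` form of `CycleCert` (same three clauses, decided). [folklore] -/
def cycleCertB (q : ℕ) (L : List (Finset (Fin 4 → ℕ) × Finset (Fin 4) × Fin 4)) : Bool :=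
  decide (L ≠ [] ∧ (L.map Prod.fst).Nodup ∧
    ∀ k : Fin L.length,
      stepB q (L.get k).1 (L.get k).2.1 (L.get k).2.2
        (L.get ⟨(k.1 + 1) % L.length, Nat.mod_lt _ k.pos⟩).1 = true)

/-- `cycleCertB` decides `CycleCert`. [folklore] -/
theorem cycleCertB_eq_true_iff (q : ℕ) (L : List (Finset (Fin 4 → ℕ) × Finset (Fin 4) × Fin 4)) :
    cycleCertB q L = true ↔ CycleCert q L := by
  unfold cycleCertB CycleCert
  exact decide_eq_true_iff

/-- Batch form: if every certificate of a list passes `cycleCertB`, every entry is a `CycleCert`. [folklore] -/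
theorem cycleCert_of_all_cycleCertB (q : ℕ)
    (B : List (List (Finset (Fin 4 → ℕ) × Finset (Fin 4) × Fin 4)))
    (h : B.all (cycleCertB q) = true) : ∀ c ∈ B, CycleCert q c :=
  fun c hc => (cycleCertB_eq_true_iff q c).mp (List.all_eq_true.mp h c hc)

end Summit.ResolutionOfSingularities.ResolutionOfSingularities.Theorems.PIDim4.SpineCert
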